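import Summits.Ventures.HSemireg.Mod4SecantValuation

/-!
# Venture HSemireg — MOD-4 OFF THE SPLIT FAMILY: the `p`-adic core of LEMMA ν, part 2 (`p = 2`, `m ≡ 1 mod 4`), and
# the last line of THEOREM G (row (F-4) of the W3 table; seat `w3-mod4-1`, files of record
# `widen/W3/MOD4-OFFSPLIT-w3mod4.md` v1.0 §7, `widen/W3/MOD4-OFFSPLIT-THEOREMS-w3mod4.md` v1.0)

HONEST FRAMING. Lean index of the computation cell `pub-hsemireg`, widening seat `w3-mod4-1`; companion of
`Mod4SecantValuation.lean` (part 1: notation, the skeleton `norm_nu_le_of_cases`, the ramified case).  ELEMENTARY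
`2`-ADIC / `p`-ADIC ARITHMETIC OF RATIONAL NUMBERS ONLY: no abelian variety, no sheaf, no Mukai vector, no Ext group and
no semiregularity map is constructed here; the geometric inputs of THEOREM G (LEMMA PIN, LEMMA HRR-SPLIT, TABLE R,
LEMMA RR-FIBRE, and the frame data (a) «q₅ ∈ ℤ_(p)» / (b) «p ∣ Q_χ(Λ_W)» resp. «16 ∣ Q_χ(Λ_W)») are NOT formalised and
are exactly the hypotheses of the statements below.  Nothing here says that HC, HC_CM or HC_AV holds, and nothing
here is a new case of anything.

*What it indexes (on paper, NOT in this file).* Branch G of THEOREM B (sheet) requires, for a totally semiregular object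
with class-exact W-alive Mukai vector `f(h) + w`, `f` K-secant over the Weil field `K`, the equation
`Q_χ(2w) = 4 (w,w)_χ = 8 D ν(f) - 8` with `2w ∈ Λ_W` (integral layer), `D = ∏ dᵢ ∈ ℤ` the polarisation degree.
THEOREM G: at a CM frame with (a) `q₅ ∈ ℤ_(p)` forced for objects and (b) `p ∣ Q_χ(Λ_W)` (`16 ∣` for `p = 2`), `p` the
ramified prime of `K`, this equation has no solution, because LEMMA ν gives `v_p(ν(f)) ≥ 2`.

CONTENT (all PROVED, 0 sorry, no definitions, no named facts), namespace `Summit.Ventures.HSemireg.Mod4`: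
* `two_norm_sub_one_le`, `two_norm_sq_sub_one_le` — a `2`-adic unit `u ∈ ℚ` has `|u ∓ 1|₂ ≤ 1/2`, `|u² - 1|₂ ≤ 1/4`
  (numerator and denominator both odd);
* `two_norm_one_add_eq`, `two_norm_P_eq_of_eq`, `two_norm_P_eq_of_ne` — for `m ≡ 1 (mod 4)` (`|m - 1|₂ ≤ 1/4`):
  `|a² + m b²|₂ = |a|₂²/2` if `|a|₂ = |b|₂`, `= max(|a|₂², |b|₂²)` otherwise;
* `two_norm_S_le`, `two_norm_delta_le`, `two_norm_S_sq_le` — the three slope conditions (A0), (B), (A) of the skeleton;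
* `lemma_nu_two` — **LEMMA ν at `p = 2`, `m ≡ 1 (mod 4)`** (`ℚ(i)`, `ℚ(√-5)`, …): `|ν(f)|₂ ≤ 1/4`; an `example` records
  the sheet's sharp value `v₂(ν) = 4` at `μ = i`, `(q₀, q₁) = (1, 0)`;
* `branchG_core_odd`, `branchG_core_two` — the last line of **THEOREM G**: `p ∣ Q` (`p` odd), resp. `16 ∣ Q` (`p = 2`),
  `D ∈ ℤ` and `|ν|_p ≤ p⁻²` make `Q = 8 D ν - 8` impossible (`|8|_p = 1`, resp. `1/8`, beats both other terms);
* `theoremG_ramified`, `theoremG_two` — the assembled arithmetic statements quoted by the theorem sheet: for a K-secant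
  h-part with `p`-integral `q₀, q₁, q₅, q₆` and `Q ∈ pℤ` (resp. `16ℤ`), `Q ≠ 8 D ν(f) - 8`.
-/

namespace Summit.Ventures.HSemireg

namespace Mod4

variable {p : ℕ} [hp : Fact p.Prime]

section Helpers

/-! ### File-private copies of two one-line `padicNorm` wrappers of part 1 -/

/-- The `p`-adic norm of a power (Mathlib's `IsAbsoluteValue.abv_pow`). -/
private theorem norm_pow (x : ℚ) (n : ℕ) : padicNorm p (x ^ n) = padicNorm p x ^ n :=
  IsAbsoluteValue.abv_pow (padicNorm p) x n

/-- Nonarchimedean bound for a sum. -/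
private theorem norm_add_le {x y t : ℚ} (hx : padicNorm p x ≤ t) (hy : padicNorm p y ≤ t) :
    padicNorm p (x + y) ≤ t :=
  le_trans padicNorm.nonarchimedean (max_le hx hy)

end Helpers

section TwoAdic

/-! ### LEMMA ν at `p = 2` for `m ≡ 1 (mod 4)` (the Weil field `ℚ(i)`; also `ℚ(√-5)`, …) -/

/-- `|2|₂ = 1/2`. -/
theorem two_norm_two : padicNorm 2 (2 : ℚ) = 2⁻¹ := by
  exact_mod_cast padicNorm.padicNorm_p_of_prime (p := 2)

/-- `|4|₂ = 1/4`. -/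
theorem two_norm_four : padicNorm 2 (4 : ℚ) = 4⁻¹ := by
  rw [show (4 : ℚ) = 2 ^ 2 by norm_num, norm_pow, two_norm_two]; norm_num

/-- A `2`-adic unit `u ∈ ℚ` is `≡ 1 (mod 2)`: `|u - 1|₂ ≤ 1/2` and `|u + 1|₂ ≤ 1/2` (numerator and denominator of
`u` are both odd). -/
theorem two_norm_sub_one_le {u : ℚ} (hu : padicNorm 2 u = 1) :
    padicNorm 2 (u - 1) ≤ 2⁻¹ ∧ padicNorm 2 (u + 1) ≤ 2⁻¹ := by
  have hden0 : (u.den : ℚ) ≠ 0 := by exact_mod_cast u.den_nz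
  have hmul : u * (u.den : ℚ) = (u.num : ℚ) := Rat.mul_den_eq_num u
  have hnd : padicNorm 2 (u.num : ℚ) = padicNorm 2 (u.den : ℚ) := by
    rw [← hmul, padicNorm.mul, hu, one_mul]
  have hden_odd : ¬ 2 ∣ u.den := by
    intro hd
    have h1 : padicNorm 2 (u.den : ℚ) < 1 := (padicNorm.nat_lt_one_iff (p := 2) u.den).mpr hd
    have h2 : padicNorm 2 (u.num : ℚ) < 1 := by rw [hnd]; exact h1
    have h3 : (2 : ℤ) ∣ u.num := (padicNorm.int_lt_one_iff (p := 2) u.num).mp h2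
    have h4 : 2 ∣ u.num.natAbs := Int.natCast_dvd.mp h3
    have h5 : 2 ∣ Nat.gcd u.num.natAbs u.den := Nat.dvd_gcd h4 hd
    rw [u.reduced] at h5
    omega
  have hden1 : padicNorm 2 (u.den : ℚ) = 1 := (padicNorm.nat_eq_one_iff (p := 2) u.den).mpr hden_odd
  have hnum1 : padicNorm 2 (u.num : ℚ) = 1 := by rw [hnd]; exact hden1
  have hnum_odd : ¬ (2 : ℤ) ∣ u.num := (padicNorm.int_eq_one_iff (p := 2) u.num).mp hnum1
  have key : ∀ z : ℤ, (2 : ℤ) ∣ z → padicNorm 2 ((z : ℚ) / (u.den : ℚ)) ≤ 2⁻¹ := by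
    intro z hz
    rw [padicNorm.div, hden1, div_one]
    have h := (padicNorm.dvd_iff_norm_le (p := 2) (n := 1) (z := z)).mp (by simpa using hz)
    calc padicNorm 2 (z : ℚ) ≤ _ := h
      _ = 2⁻¹ := by norm_num
  constructor
  · have e : u - 1 = ((u.num - u.den : ℤ) : ℚ) / (u.den : ℚ) := by
      rw [eq_div_iff hden0]; push_cast; linear_combination hmul
    rw [e]
    exact key _ (by omega)
  · have e : u + 1 = ((u.num + u.den : ℤ) : ℚ) / (u.den : ℚ) := by
      rw [eq_div_iff hden0]; push_cast; linear_combination hmul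
    rw [e]
    exact key _ (by omega)

/-- Hence `|u² - 1|₂ ≤ 1/4` for a `2`-adic unit `u` (`u² ≡ 1 mod 4`; in fact `mod 8`, not needed). -/
theorem two_norm_sq_sub_one_le {u : ℚ} (hu : padicNorm 2 u = 1) : padicNorm 2 (u ^ 2 - 1) ≤ 4⁻¹ := by
  obtain ⟨h1, h2⟩ := two_norm_sub_one_le hu
  rw [show u ^ 2 - 1 = (u - 1) * (u + 1) by ring, padicNorm.mul]
  calc padicNorm 2 (u - 1) * padicNorm 2 (u + 1) ≤ 2⁻¹ * 2⁻¹ :=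
        mul_le_mul h1 h2 (padicNorm.nonneg _) (by norm_num)
    _ = 4⁻¹ := by norm_num

/-- `m ≡ 1 (mod 4)` as a `2`-adic statement (`|m - 1|₂ ≤ 1/4`) makes `m` a `2`-adic unit. -/
theorem two_norm_m_eq_one {m : ℚ} (hm : padicNorm 2 (m - 1) ≤ 4⁻¹) : padicNorm 2 m = 1 := by
  have e : m = 1 + (m - 1) := by ring
  rw [e, norm_add_eq_left_of_lt, padicNorm.one]
  rw [padicNorm.one]; exact lt_of_le_of_lt hm (by norm_num)

/-- For a `2`-adic unit `w` and `m ≡ 1 (mod 4)`: `|1 + m w²|₂ = 1/2` («a sum of two odd squares is `2 mod 4`»). -/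
theorem two_norm_one_add_eq {m w : ℚ} (hm : padicNorm 2 (m - 1) ≤ 4⁻¹) (hw : padicNorm 2 w = 1) :
    padicNorm 2 (1 + m * w ^ 2) = 2⁻¹ := by
  have hw2 := two_norm_sq_sub_one_le hw
  have e : 1 + m * w ^ 2 = 2 + ((m - 1) * w ^ 2 + (w ^ 2 - 1)) := by ring
  have hrest : padicNorm 2 ((m - 1) * w ^ 2 + (w ^ 2 - 1)) ≤ 4⁻¹ :=
    norm_add_le (norm_mul_le_left hm (by rw [norm_pow, hw, one_pow])) hw2
  rw [e, norm_add_eq_left_of_lt, two_norm_two]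
  rw [two_norm_two]; exact lt_of_le_of_lt hrest (by norm_num)

/-- `|a² + m b²|₂ = |a|₂² / 2` when `|a|₂ = |b|₂`, for `m ≡ 1 (mod 4)` (pencil: `v_π(μ) = -1 + 2 v_2(a)` when
`μ = a + b√-m` has `v_2(a) = v_2(b)`). -/
theorem two_norm_P_eq_of_eq {m a b : ℚ} (hm : padicNorm 2 (m - 1) ≤ 4⁻¹)
    (hab : padicNorm 2 a = padicNorm 2 b) :
    padicNorm 2 (a ^ 2 + m * b ^ 2) = padicNorm 2 a ^ 2 * 2⁻¹ := by
  by_cases ha : a = 0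
  · have hb : b = 0 := by
      apply padicNorm.zero_of_padicNorm_eq_zero (p := 2)
      rw [← hab, ha, padicNorm.zero]
    subst ha; subst hb; simp
  · have hw : padicNorm 2 (b / a) = 1 := by
      rw [padicNorm.div, ← hab, div_self (padicNorm.nonzero ha)]
    have e : a ^ 2 + m * b ^ 2 = a ^ 2 * (1 + m * (b / a) ^ 2) := by
      field_simp
    rw [e, padicNorm.mul, norm_pow, two_norm_one_add_eq hm hw]

/-- `|a² + m b²|₂ = max(|a|₂², |b|₂²)` when `|a|₂ ≠ |b|₂` and `m` is a `2`-adic unit. -/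
theorem two_norm_P_eq_of_ne {m a b : ℚ} (hm1 : padicNorm 2 m = 1) (hab : padicNorm 2 a ≠ padicNorm 2 b) :
    padicNorm 2 (a ^ 2 + m * b ^ 2) = max (padicNorm 2 a ^ 2) (padicNorm 2 b ^ 2) := by
  have hne : padicNorm 2 (a ^ 2) ≠ padicNorm 2 (m * b ^ 2) := by
    rw [norm_pow, padicNorm.mul, norm_pow, hm1, one_mul]
    intro h
    exact hab ((pow_left_inj₀ (padicNorm.nonneg _) (padicNorm.nonneg _) two_ne_zero).mp h)
  rw [padicNorm.add_eq_max_of_ne hne, norm_pow, padicNorm.mul, norm_pow, hm1, one_mul]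

/-- Condition (A0) at `p = 2`, `m ≡ 1 (4)`: `|Nm μ|₂ ≤ 1 ⇒ |Tr μ|₂ ≤ 1`. -/
theorem two_norm_S_le {m : ℚ} (hm : padicNorm 2 (m - 1) ≤ 4⁻¹) {a b : ℚ}
    (hP : padicNorm 2 (a ^ 2 + m * b ^ 2) ≤ 1) : padicNorm 2 (2 * a) ≤ 1 := by
  rw [padicNorm.mul, two_norm_two]
  have ha0 := padicNorm.nonneg (p := 2) a
  rcases eq_or_ne (padicNorm 2 a) (padicNorm 2 b) with hab | hab
  · rw [two_norm_P_eq_of_eq hm hab] at hP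
    nlinarith
  · rw [two_norm_P_eq_of_ne (two_norm_m_eq_one hm) hab] at hP
    have : padicNorm 2 a ^ 2 ≤ 1 := le_trans (le_max_left _ _) hP
    nlinarith

/-- Condition (B) at `p = 2`, `m ≡ 1 (4)`: an integral slope has `|Δ|₂ = |4 m b²|₂ ≤ 1/2`. -/
theorem two_norm_delta_le {m : ℚ} (hm : padicNorm 2 (m - 1) ≤ 4⁻¹) {a b : ℚ}
    (hP : padicNorm 2 (a ^ 2 + m * b ^ 2) ≤ 1) :
    padicNorm 2 (4 * (a ^ 2 + m * b ^ 2) - (2 * a) ^ 2) ≤ 2⁻¹ := by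
  have hm1 := two_norm_m_eq_one hm
  have e : 4 * (a ^ 2 + m * b ^ 2) - (2 * a) ^ 2 = 4 * (m * b ^ 2) := by ring
  rw [e, padicNorm.mul, padicNorm.mul, two_norm_four, hm1, norm_pow, one_mul]
  have hb0 := padicNorm.nonneg (p := 2) b
  rcases eq_or_ne (padicNorm 2 a) (padicNorm 2 b) with hab | hab
  · rw [two_norm_P_eq_of_eq hm hab, hab] at hP
    nlinarith
  · rw [two_norm_P_eq_of_ne hm1 hab] at hP
    have : padicNorm 2 b ^ 2 ≤ 1 := le_trans (le_max_right _ _) hP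
    nlinarith

/-- Condition (A) at `p = 2`, `m ≡ 1 (4)`: `|Tr μ|₂² ≤ |Nm μ|₂` (here unconditionally). -/
theorem two_norm_S_sq_le {m : ℚ} (hm : padicNorm 2 (m - 1) ≤ 4⁻¹) (a b : ℚ) :
    padicNorm 2 (2 * a) ^ 2 ≤ padicNorm 2 (a ^ 2 + m * b ^ 2) := by
  rw [padicNorm.mul, two_norm_two, mul_pow]
  have ha0 := sq_nonneg (padicNorm 2 a)
  rcases eq_or_ne (padicNorm 2 a) (padicNorm 2 b) with hab | hab
  · rw [two_norm_P_eq_of_eq hm hab]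
    nlinarith
  · rw [two_norm_P_eq_of_ne (two_norm_m_eq_one hm) hab]
    calc (2⁻¹ : ℚ) ^ 2 * padicNorm 2 a ^ 2 ≤ padicNorm 2 a ^ 2 := by nlinarith
      _ ≤ _ := le_max_left _ _

/-- **LEMMA ν (`p = 2`, `m ≡ 1 mod 4`).**  Let `m ∈ ℚ` with `|m - 1|₂ ≤ 1/4` (e.g. `m = 1`: the Weil field `ℚ(i)`).
For a K-secant h-part with slope `μ = a + b√-m` whose `q₀ = r`, `q₁`, `q₅`, `q₆` are `2`-integral,
`ν(f) = Δ² · Nm(q₁ - q₀ μ̄)` satisfies `|ν(f)|₂ ≤ 1/4`, i.e. `v_2(ν(f)) ≥ 2`.  (Sheet: LEMMA ν, `p = 2, m ∈ {1, 2}`;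
`m = 2` is the case `|m|₂ = 2⁻¹` of `lemma_nu_ramified`.) -/
theorem lemma_nu_two (m a b r q₁ : ℚ) (hm : padicNorm 2 (m - 1) ≤ 4⁻¹)
    (hr : padicNorm 2 r ≤ 1) (hq₁ : padicNorm 2 q₁ ≤ 1)
    (hq₅ : padicNorm 2 (qseq (2 * a) (a ^ 2 + m * b ^ 2) r q₁ 5) ≤ 1)
    (hq₆ : padicNorm 2 (qseq (2 * a) (a ^ 2 + m * b ^ 2) r q₁ 6) ≤ 1) :
    padicNorm 2 ((4 * m * b ^ 2) ^ 2 * normForm (2 * a) (a ^ 2 + m * b ^ 2) r q₁)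
      ≤ ((2 : ℚ) ^ 2)⁻¹ := by
  have hΔ : 4 * m * b ^ 2 = 4 * (a ^ 2 + m * b ^ 2) - (2 * a) ^ 2 := by ring
  rw [hΔ]
  have hB : padicNorm 2 (a ^ 2 + m * b ^ 2) ≤ 1 → padicNorm 2 (2 * a) ≤ 1 →
      padicNorm 2 (4 * (a ^ 2 + m * b ^ 2) - (2 * a) ^ 2) ≤ ((2 : ℕ) : ℚ)⁻¹ := by
    intro hP _
    exact_mod_cast two_norm_delta_le hm hP
  have h := norm_nu_le_of_cases (p := 2) (2 * a) (a ^ 2 + m * b ^ 2) r q₁ hr hq₁ hq₅ hq₆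
    (fun hP => two_norm_S_le hm hP) hB (fun _ => two_norm_S_sq_le hm a b)
  exact_mod_cast h

/-- Non-vacuity / sharpness witness for `lemma_nu_two` at `K = ℚ(i)` (`m = 1`): the slope `μ = i` (`a = 0`, `b = 1`,
`S = 0`, `P = 1`, `Δ = 4`) with `(q₀, q₁) = (1, 0)` has `q = (1, 0, -1, 0, 1, 0, -1)`, all integral, and
`ν = Δ² · 1 = 16` of `2`-adic norm `2⁻⁴ ≤ 2⁻²` (the sheet's machine-checked minimum `v₂(ν) = 4` for `ℚ(i)`). -/
example : padicNorm 2 ((4 * 1 * (1 : ℚ) ^ 2) ^ 2 * normForm (2 * 0) (0 ^ 2 + 1 * 1 ^ 2) 1 0) = ((2 : ℚ) ^ 4)⁻¹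
    ∧ qseq (2 * 0 : ℚ) (0 ^ 2 + 1 * 1 ^ 2) 1 0 5 = 0
    ∧ qseq (2 * 0 : ℚ) (0 ^ 2 + 1 * 1 ^ 2) 1 0 6 = -1 := by
  refine ⟨?_, ?_, ?_⟩
  · have e : (4 * 1 * (1 : ℚ) ^ 2) ^ 2 * normForm (2 * 0) (0 ^ 2 + 1 * 1 ^ 2) 1 0 = (2 : ℚ) ^ 4 := by
      simp only [normForm]; norm_num
    rw [e, norm_pow, two_norm_two, inv_pow]
  · simp only [qseq]; norm_num
  · simp only [qseq]; norm_num

end TwoAdic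

section BranchG

/-! ### The last line of THEOREM G: Branch G's equation `Q_χ(2w) = 8 D ν(f) - 8` has no solution -/

/-- **THEOREM G, arithmetic core, odd `p`.**  If `p ∣ Q` (pencil: `p ∣ Q_χ(Λ_W)` and `2w ∈ Λ_W`), `D ∈ ℤ` and
`|ν|_p ≤ p⁻²` (LEMMA ν), then `Q ≠ 8 D ν - 8`: `|8|_p = 1` while `|8 D ν - Q|_p < 1`.  (For odd `p` even `|ν|_p ≤ p⁻¹`
would do; the hypothesis is stated as LEMMA ν delivers it.) -/
theorem branchG_core_odd (hp2 : p ≠ 2) (Q D : ℤ) (ν : ℚ) (hQ : (p : ℤ) ∣ Q)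
    (hν : padicNorm p ν ≤ ((p : ℚ) ^ 2)⁻¹) : (Q : ℚ) ≠ 8 * D * ν - 8 := by
  intro h
  have h8 : padicNorm p (8 : ℚ) = 1 := by
    have hnd : ¬ p ∣ 8 := by
      intro hd
      have h2 : p ∣ 2 := hp.out.dvd_of_dvd_pow (show p ∣ 2 ^ 3 by simpa using hd)
      exact hp2 ((Nat.prime_dvd_prime_iff_eq hp.out Nat.prime_two).mp h2)
    exact_mod_cast (padicNorm.nat_eq_one_iff (p := p) 8).mpr hnd
  have hQ' : padicNorm p (Q : ℚ) < 1 := (padicNorm.int_lt_one_iff (p := p) Q).mpr hQ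
  have hD : padicNorm p (D : ℚ) ≤ 1 := norm_intCast_le_one D
  have hp1 : ((p : ℚ) ^ 2)⁻¹ < 1 :=
    inv_lt_one_of_one_lt₀ (one_lt_pow₀ (by exact_mod_cast hp.out.one_lt : (1 : ℚ) < p) two_ne_zero)
  have hν' : padicNorm p (8 * D * ν) < 1 :=
    lt_of_le_of_lt (norm_mul_le_right (norm_mul_le_right (le_of_eq h8) hD) hν) hp1
  have e : (8 : ℚ) = 8 * D * ν - Q := by rw [h]; ring
  have h' : padicNorm p (8 : ℚ) < 1 := by rw [e]; exact norm_sub_lt hν' hQ'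
  rw [h8] at h'
  exact lt_irrefl _ h'

/-- **THEOREM G, arithmetic core, `p = 2`.**  If `16 ∣ Q` (pencil: `16 ∣ Q_χ(Λ_W)` and `2w ∈ Λ_W`), `D ∈ ℤ` and
`|ν|₂ ≤ 1/4`, then `Q ≠ 8 D ν - 8`: `|8|₂ = 1/8` while `|8 D ν|₂ ≤ 1/32` and `|Q|₂ ≤ 1/16`
(pencil: `v₂(8Dν - 8) = 3 < 4`). -/
theorem branchG_core_two (Q D : ℤ) (ν : ℚ) (hQ : (16 : ℤ) ∣ Q)
    (hν : padicNorm 2 ν ≤ ((2 : ℚ) ^ 2)⁻¹) : (Q : ℚ) ≠ 8 * D * ν - 8 := by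
  intro h
  have h8 : padicNorm 2 (8 : ℚ) = 8⁻¹ := by
    rw [show (8 : ℚ) = 2 ^ 3 by norm_num, norm_pow, two_norm_two]; norm_num
  have h16 := (padicNorm.dvd_iff_norm_le (p := 2) (n := 4) (z := Q)).mp (by simpa using hQ)
  have hQ' : padicNorm 2 (Q : ℚ) ≤ 16⁻¹ := by
    calc padicNorm 2 (Q : ℚ) ≤ _ := h16
      _ = 16⁻¹ := by norm_num
  have hD : padicNorm 2 (D : ℚ) ≤ 1 := norm_intCast_le_one D
  have hν' : padicNorm 2 (8 * D * ν) ≤ 32⁻¹ := by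
    rw [padicNorm.mul, padicNorm.mul, h8]
    calc 8⁻¹ * padicNorm 2 (D : ℚ) * padicNorm 2 ν ≤ 8⁻¹ * 1 * ((2 : ℚ) ^ 2)⁻¹ :=
          mul_le_mul (mul_le_mul_of_nonneg_left hD (by norm_num)) hν (padicNorm.nonneg _) (by norm_num)
      _ = 32⁻¹ := by norm_num
  have e : (8 : ℚ) = 8 * D * ν - Q := by rw [h]; ring
  have h' : padicNorm 2 (8 * D * ν - Q) < 8⁻¹ :=
    norm_sub_lt (lt_of_le_of_lt hν' (by norm_num)) (lt_of_le_of_lt hQ' (by norm_num))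
  rw [← e, h8] at h'
  exact lt_irrefl _ h'

/-- **THEOREM G (arithmetic form), ramified odd prime.**  `K = ℚ(√-m)`, `p` an odd prime with `|m|_p = p⁻¹`;
a K-secant h-part `f` with slope `μ = a + b√-m` and `p`-integral `q₀, q₁, q₅, q₆` (frame hypothesis (a) of THEOREM G
supplies `q₅`; `q₀ = rank`, `q₆ = χ(E)` and `q₁` are integers for objects); `D ∈ ℤ` the polarisation degree and
`Q = Q_χ(2w) ∈ pℤ` (frame hypothesis (b)).  Then the Branch-G equation `Q = 8 D ν(f) - 8` is impossible. -/
theorem theoremG_ramified (hp2 : p ≠ 2) (m a b r q₁ : ℚ) (hm : padicNorm p m = (p : ℚ)⁻¹)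
    (hr : padicNorm p r ≤ 1) (hq₁ : padicNorm p q₁ ≤ 1)
    (hq₅ : padicNorm p (qseq (2 * a) (a ^ 2 + m * b ^ 2) r q₁ 5) ≤ 1)
    (hq₆ : padicNorm p (qseq (2 * a) (a ^ 2 + m * b ^ 2) r q₁ 6) ≤ 1)
    (Q D : ℤ) (hQ : (p : ℤ) ∣ Q) :
    (Q : ℚ) ≠ 8 * D * ((4 * m * b ^ 2) ^ 2 * normForm (2 * a) (a ^ 2 + m * b ^ 2) r q₁) - 8 :=
  branchG_core_odd hp2 Q D _ hQ (lemma_nu_ramified m a b r q₁ hm hr hq₁ hq₅ hq₆)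

/-- **THEOREM G (arithmetic form), `p = 2`.**  `K = ℚ(√-m)` with `2` ramified: `m ≡ 1 (mod 4)` (`|m - 1|₂ ≤ 1/4`,
e.g. `ℚ(i)`) or `m ≡ 2 (mod 4)` (`|m|₂ = 1/2`, e.g. `ℚ(√-2)`, `ℚ(√-6)`); a K-secant h-part with `2`-integral
`q₀, q₁, q₅, q₆`; `D ∈ ℤ` and `16 ∣ Q = Q_χ(2w)` (frame hypothesis (b) at `p = 2`).  Then `Q = 8 D ν(f) - 8` is
impossible. -/
theorem theoremG_two (m a b r q₁ : ℚ) (hm : padicNorm 2 (m - 1) ≤ 4⁻¹ ∨ padicNorm 2 m = 2⁻¹)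
    (hr : padicNorm 2 r ≤ 1) (hq₁ : padicNorm 2 q₁ ≤ 1)
    (hq₅ : padicNorm 2 (qseq (2 * a) (a ^ 2 + m * b ^ 2) r q₁ 5) ≤ 1)
    (hq₆ : padicNorm 2 (qseq (2 * a) (a ^ 2 + m * b ^ 2) r q₁ 6) ≤ 1)
    (Q D : ℤ) (hQ : (16 : ℤ) ∣ Q) :
    (Q : ℚ) ≠ 8 * D * ((4 * m * b ^ 2) ^ 2 * normForm (2 * a) (a ^ 2 + m * b ^ 2) r q₁) - 8 := by
  refine branchG_core_two Q D _ hQ ?_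
  rcases hm with hm | hm
  · exact lemma_nu_two m a b r q₁ hm hr hq₁ hq₅ hq₆
  · have hm' : padicNorm 2 m = ((2 : ℕ) : ℚ)⁻¹ := by exact_mod_cast hm
    exact_mod_cast lemma_nu_ramified (p := 2) m a b r q₁ hm' hr hq₁ hq₅ hq₆

end BranchG

end Mod4

end Summit.Ventures.HSemireg
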